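import Literature.AlgebraicGeometry.Resolution.DefectlessComposite
import HarnessLib

/-!
# Transport of `e`, `f` and defectlessness along isomorphisms of valued fields

Topic: `Literature/AlgebraicGeometry/Resolution` (valued function fields). PROVED bookkeeping for the
finite-level proof of Kuhlmann 2010, Cor. 2.25 (`Kuhlmann2010DefectlessDescent`,
`GeneralizedStabilityTrdegOne.lean`): the invariants `e = (vL : vK)`, `f = [Lv : Kv]` of an extension
of valued fields `(L, L°)/K` (`ramificationIndex`, `inertiaDegree`, `ValuationDefect.lean`) and the
properties "`(K, K°)` is defectless in `L`" (`IsDefectlessIn`), "`(K, K°)` is a defectless field"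
(`IsDefectlessField`) are invariant under isomorphisms of valued fields — in particular under
`K`-automorphisms of `L` acting on the extensions of `K°` to `L` (Zariski–Samuel II, Ch. VI §7:
"conjugate places … `𝒫₂* = s𝒫₁*`" have the same value group and residue field over `K`).

## Content (everything PROVED, [folklore])

* `ramificationIndex_congr` (through the intrinsic form `e(S/K) = [L^× : K^× S^×]`,
  `ramificationIndex_eq_index` of `DefectlessComposite.lean`), `inertiaDegree_congr` — for a
  square of field isomorphisms
  `φ : K₁ ≃ K₂`, `ψ : L₁ ≃ L₂` compatible with `Kᵢ → Lᵢ` and valuation rings `W₁ = ψ⁻¹(W₂)`: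
  `e(W₁/K₁) = e(W₂/K₂)`, `f(W₁/K₁) = f(W₂/K₂)`.
* `IsDefectlessIn.congr`, `IsDefectlessField.congr` — the same for defectlessness.
* `ramificationIndex_comap_algEquiv`, `inertiaDegree_comap_algEquiv` — `e`, `f` of `σ⁻¹(W)` for a
  `K`-automorphism `σ` of `L` equal those of `W`.

## Sources

* O. Zariski, P. Samuel, *Commutative Algebra* II (1960), Ch. VI §7 (conjugate places), §11
  (p. 55: translation to valuations). [folklore]
-/

noncomputable section

open IsLocalRing

namespace Literature.AlgebraicGeometry.Resolution

universe u


section Congr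

variable {K₁ K₂ L₁ L₂ : Type u} [Field K₁] [Field K₂] [Field L₁] [Field L₂] [Algebra K₁ L₁]
  [Algebra K₂ L₂] (φ : K₁ ≃+* K₂) (ψ : L₁ ≃+* L₂)
  (hc : ∀ x : K₁, ψ (algebraMap K₁ L₁ x) = algebraMap K₂ L₂ (φ x))
  {W₁ : ValuationSubring L₁} {W₂ : ValuationSubring L₂} (hW : W₁ = W₂.comap ψ.toRingHom)

include hW in
/-- Units of `W₁ = ψ⁻¹(W₂)` go to units of `W₂`. [folklore] -/
theorem map_unitGroup_eq :
    W₁.unitGroup.map (Units.map (ψ : L₁ →* L₂)) = W₂.unitGroup := by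
  ext y
  rw [Subgroup.mem_map]
  constructor
  · rintro ⟨x, hx, rfl⟩
    rw [mem_unitGroup_iff_mem] at hx ⊢
    rw [hW] at hx
    simpa [ValuationSubring.mem_comap] using hx
  · intro hy
    refine ⟨Units.map (ψ.symm : L₂ →* L₁) y, ?_, ?_⟩
    · rw [mem_unitGroup_iff_mem] at hy ⊢
      rw [hW]
      simpa [ValuationSubring.mem_comap] using hy
    · ext
      simp

include hc in
/-- `Kˣ₁ ⊆ L₁ˣ` goes to `K₂ˣ ⊆ L₂ˣ`. [folklore] -/
theorem map_range_units_eq :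
    ((Units.map (algebraMap K₁ L₁ : K₁ →* L₁)).range).map (Units.map (ψ : L₁ →* L₂)) =
      (Units.map (algebraMap K₂ L₂ : K₂ →* L₂)).range := by
  ext y
  constructor
  · rintro ⟨_, ⟨c, rfl⟩, rfl⟩
    refine ⟨Units.map (φ : K₁ →* K₂) c, Units.ext ?_⟩
    simp [hc]
  · rintro ⟨c, rfl⟩
    refine ⟨Units.map (algebraMap K₁ L₁ : K₁ →* L₁) (Units.map (φ.symm : K₂ →* K₁) c),
      ⟨_, rfl⟩, Units.ext ?_⟩
    simp [hc]

include hc hW in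
/-- **`e` is invariant under isomorphisms of valued fields.** [folklore] -/
theorem ramificationIndex_congr : ramificationIndex K₁ W₁ = ramificationIndex K₂ W₂ := by
  rw [ramificationIndex_eq_index, ramificationIndex_eq_index]
  unfold unitsSup
  rw [← map_range_units_eq φ ψ hc, ← map_unitGroup_eq ψ hW, ← Subgroup.map_sup,
    Subgroup.index_map_of_bijective]
  exact (Units.mapEquiv ψ.toMulEquiv).bijective

include hW in
/-- Membership transport: `x ∈ W₁ ↔ ψ x ∈ W₂`. [folklore] -/
theorem mem_iff_map_mem (x : L₁) : x ∈ W₁ ↔ ψ x ∈ W₂ := by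
  rw [hW, ValuationSubring.mem_comap]
  rfl

include hc hW in
/-- **`f` is invariant under isomorphisms of valued fields** (`ψ` restricts to `W₁ ≃ W₂`, whence an
isomorphism of residue fields mapping `K̃₁` onto `K̃₂`). [folklore] -/
theorem inertiaDegree_congr : inertiaDegree K₁ W₁ = inertiaDegree K₂ W₂ := by
  unfold inertiaDegree
  -- the ring isomorphism `W₁ ≃ W₂` induced by `ψ`
  let θ : W₁ ≃+* W₂ :=
    { toFun := fun x => ⟨ψ x, (mem_iff_map_mem ψ hW x).mp x.2⟩
      invFun := fun y => ⟨ψ.symm y, (mem_iff_map_mem ψ hW _).mpr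
        (by rw [RingEquiv.apply_symm_apply]; exact y.2)⟩
      left_inv := fun x => Subtype.ext (ψ.symm_apply_apply x)
      right_inv := fun y => Subtype.ext (ψ.apply_symm_apply y)
      map_mul' := fun x y => Subtype.ext (map_mul ψ (x : L₁) y)
      map_add' := fun x y => Subtype.ext (map_add ψ (x : L₁) y) }
  have hθ : ∀ x : W₁, ((θ x : W₂) : L₂) = ψ x := fun x => rfl
  -- the induced isomorphism of residue fields
  let ρ : ResidueField W₁ ≃+* ResidueField W₂ := ResidueField.mapEquiv θ
  have hρ : ∀ x : W₁, ρ (residue W₁ x) = residue W₂ (θ x) := fun x => by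
    change ResidueField.mapEquiv θ (residue W₁ x) = _
    rw [ResidueField.mapEquiv_apply]
    exact ResidueField.map_residue _ _
  -- it maps `K̃₁ ⊆ L̃₁` onto `K̃₂ ⊆ L̃₂`
  have hmap : (residueSubfield K₁ W₁).map ρ.toRingHom = residueSubfield K₂ W₂ := by
    ext r
    rw [Subfield.mem_map]
    constructor
    · rintro ⟨r₁, hr₁, rfl⟩
      obtain ⟨c, h, rfl⟩ := (mem_residueSubfield_iff K₁ W₁ r₁).mp hr₁
      rw [RingEquiv.toRingHom_eq_coe, RingHom.coe_coe, hρ]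
      refine (mem_residueSubfield_iff K₂ W₂ _).mpr ⟨φ c, ?_, ?_⟩
      · rw [← hc]; exact (mem_iff_map_mem ψ hW _).mp h
      · congr 1
        exact Subtype.ext (hc c).symm
    · intro hr
      obtain ⟨c, h, rfl⟩ := (mem_residueSubfield_iff K₂ W₂ r).mp hr
      have h₁ : algebraMap K₁ L₁ (φ.symm c) ∈ W₁ := by
        rw [mem_iff_map_mem ψ hW, hc, RingEquiv.apply_symm_apply]; exact h
      refine ⟨residue W₁ ⟨algebraMap K₁ L₁ (φ.symm c), h₁⟩,
        residue_mem_residueSubfield K₁ W₁ _ h₁, ?_⟩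
      rw [RingEquiv.toRingHom_eq_coe, RingHom.coe_coe, hρ]
      congr 1
      apply Subtype.ext
      change ψ (algebraMap K₁ L₁ (φ.symm c)) = algebraMap K₂ L₂ c
      rw [hc, RingEquiv.apply_symm_apply]
  -- the restriction of `ρ` to the residue subfields
  let i : residueSubfield K₁ W₁ ≃+* residueSubfield K₂ W₂ :=
    { toFun := fun r => ⟨ρ r, by rw [← hmap]; exact Subfield.mem_map.mpr ⟨r, r.2, rfl⟩⟩
      invFun := fun r => ⟨ρ.symm r, by
        have hr : (r : ResidueField W₂) ∈ (residueSubfield K₁ W₁).map ρ.toRingHom := by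
          rw [hmap]; exact r.2
        obtain ⟨r₁, hr₁, hr₁r⟩ := Subfield.mem_map.mp hr
        rw [← hr₁r]
        change ρ.symm (ρ r₁) ∈ residueSubfield K₁ W₁
        rw [RingEquiv.symm_apply_apply]
        exact hr₁⟩
      left_inv := fun r => Subtype.ext (ρ.symm_apply_apply r)
      right_inv := fun r => Subtype.ext (ρ.apply_symm_apply r)
      map_mul' := fun r s => Subtype.ext (map_mul ρ (r : ResidueField W₁) s)
      map_add' := fun r s => Subtype.ext (map_add ρ (r : ResidueField W₁) s) }
  exact Algebra.finrank_eq_of_equiv_equiv i ρ (RingHom.ext fun r => rfl)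

/-- `comap` along `ψ⁻¹` then `ψ` is the identity. [folklore] -/
theorem comap_ringEquiv_symm_comap {L₁ L₂ : Type u} [Field L₁] [Field L₂] (ψ : L₁ ≃+* L₂)
    (W : ValuationSubring L₁) : (W.comap ψ.symm.toRingHom).comap ψ.toRingHom = W := by
  ext x
  simp [ValuationSubring.mem_comap]

/-- `comap` along `ψ` then `ψ⁻¹` is the identity. [folklore] -/
theorem comap_comap_ringEquiv_symm {L₁ L₂ : Type u} [Field L₁] [Field L₂] (ψ : L₁ ≃+* L₂)
    (W : ValuationSubring L₂) : (W.comap ψ.toRingHom).comap ψ.symm.toRingHom = W := by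
  ext x
  simp [ValuationSubring.mem_comap]

include hc in
/-- **Defectlessness in a finite extension is invariant under isomorphisms of valued fields**:
for `φ : K₁ ≃ K₂`, `ψ : L₁ ≃ L₂` compatible with `Kᵢ → Lᵢ` and `O₁ = φ⁻¹(O₂)`,
`(K₁, O₁)` defectless in `L₁` implies `(K₂, O₂)` defectless in `L₂`. [folklore] -/
theorem IsDefectlessIn.congr {O₁ : ValuationSubring K₁} {O₂ : ValuationSubring K₂}
    (hO : O₁ = O₂.comap φ.toRingHom) (h : IsDefectlessIn K₁ O₁ L₁) : IsDefectlessIn K₂ O₂ L₂ := by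
  classical
  obtain ⟨s, hs, hsum⟩ := h
  -- transport of the extensions: `W ↦ ψ(W) = (ψ⁻¹)⁻¹(W)`
  let T : ValuationSubring L₁ → ValuationSubring L₂ := fun W => W.comap ψ.symm.toRingHom
  have hTinj : Function.Injective T := fun W W' hWW' => by
    have := congrArg (fun W => ValuationSubring.comap W ψ.toRingHom) hWW'
    simpa only [T, comap_ringEquiv_symm_comap] using this
  have halg : ∀ W : ValuationSubring L₁,
      (T W).comap (algebraMap K₂ L₂) = (W.comap (algebraMap K₁ L₁)).comap φ.symm.toRingHom := by
    intro W
    ext c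
    simp only [ValuationSubring.mem_comap, T]
    change ψ.symm (algebraMap K₂ L₂ c) ∈ W ↔ algebraMap K₁ L₁ (φ.symm c) ∈ W
    rw [← ψ.symm_apply_apply (algebraMap K₁ L₁ (φ.symm c)), hc, RingEquiv.apply_symm_apply]
  have hO₂ : O₂ = O₁.comap φ.symm.toRingHom := by
    rw [hO]; ext c; simp [ValuationSubring.mem_comap]
  refine ⟨s.image T, fun W₂' => ?_, ?_⟩
  · rw [Finset.mem_image]
    constructor
    · rintro ⟨W, hW, rfl⟩
      rw [halg, (hs W).mp hW, hO₂]
    · intro hW₂'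
      refine ⟨W₂'.comap ψ.toRingHom, (hs _).mpr ?_, comap_comap_ringEquiv_symm ψ W₂'⟩
      have h1 := halg (W₂'.comap ψ.toRingHom)
      rw [show T (W₂'.comap ψ.toRingHom) = W₂' from comap_comap_ringEquiv_symm ψ W₂', hW₂', hO₂] at h1
      have h2 := congrArg (fun O => ValuationSubring.comap O φ.toRingHom) h1
      simp only [ValuationSubring.comap_comap] at h2
      convert h2.symm using 2 <;> ext c <;> simp [ValuationSubring.mem_comap]
  · rw [Finset.sum_image fun W _ W' _ h => hTinj h, ← Algebra.finrank_eq_of_equiv_equiv φ ψ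
      (RingHom.ext fun x => (hc x).symm), ← hsum]
    refine Finset.sum_congr rfl fun W _ => ?_
    rw [ramificationIndex_congr φ ψ hc (comap_ringEquiv_symm_comap ψ W).symm,
      inertiaDegree_congr φ ψ hc (comap_ringEquiv_symm_comap ψ W).symm]

/-- **A defectless field stays defectless under an isomorphism of valued fields**
`φ : (E₁, O₁) ≃ (E₂, O₂)` (`O₁ = φ⁻¹(O₂)`). [folklore] -/
theorem IsDefectlessField.congr {E₁ E₂ : Type u} [Field E₁] [Field E₂] (φ : E₁ ≃+* E₂)
    {O₁ : ValuationSubring E₁} {O₂ : ValuationSubring E₂} (hO : O₁ = O₂.comap φ.toRingHom)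
    (h : IsDefectlessField E₁ O₁) : IsDefectlessField E₂ O₂ := by
  intro L _ _ hfin
  letI alg₁ : Algebra E₁ L := ((algebraMap E₂ L).comp φ.toRingHom).toAlgebra
  haveI : FiniteDimensional E₁ L := by
    haveI := hfin
    exact Module.Finite.of_equiv_equiv (A₁ := E₂) (B₁ := L) (A₂ := E₁) (B₂ := L) φ.symm
      (RingEquiv.refl L) (by ext c; change algebraMap E₂ L (φ (φ.symm c)) = algebraMap E₂ L c; simp)
  have h₁ : IsDefectlessIn E₁ O₁ L := h L inferInstance
  exact IsDefectlessIn.congr (L₁ := L) (L₂ := L) φ (RingEquiv.refl L) (fun x => rfl) hO h₁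

end Congr

section AlgEquiv

variable (K : Type u) {L : Type u} [Field K] [Field L] [Algebra K L] (W : ValuationSubring L)
  (σ : L ≃ₐ[K] L)

/-- A `K`-automorphism moves extensions of `K°` to extensions of `K°`:
`σ⁻¹(W) ∩ K = W ∩ K`. [folklore] -/
theorem comap_algEquiv_comap_algebraMap :
    (W.comap (σ : L →+* L)).comap (algebraMap K L) = W.comap (algebraMap K L) := by
  ext c
  simp [ValuationSubring.mem_comap]

/-- **`e(σ⁻¹(W)/K) = e(W/K)`** for a `K`-automorphism `σ` of `L` (conjugate extensions have the
same value group over `K`). [folklore] -/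
theorem ramificationIndex_comap_algEquiv :
    ramificationIndex K (W.comap (σ : L →+* L)) = ramificationIndex K W :=
  ramificationIndex_congr (RingEquiv.refl K) (σ : L ≃+* L) (fun x => by simp) (by rfl)

/-- **`f(σ⁻¹(W)/K) = f(W/K)`** for a `K`-automorphism `σ` of `L`. [folklore] -/
theorem inertiaDegree_comap_algEquiv :
    inertiaDegree K (W.comap (σ : L →+* L)) = inertiaDegree K W :=
  inertiaDegree_congr (RingEquiv.refl K) (σ : L ≃+* L) (fun x => by simp) (by rfl)

end AlgEquiv

end Literature.AlgebraicGeometry.Resolution
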